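import Mathlib
import HarnessLib
import Summits.HubbardSuperconductivity.HubbardSuperconductivity.Theorems.KLProgrammeKLRegimeEngineV8DefsQ3
import Summits.HubbardSuperconductivity.HubbardSuperconductivity.Theorems.KLProgrammeFermiSurfaceBandConstants

/-!
# Threshold bridges of the K3 engine's stub binders for the SYMBOL-LAYER corollaries: `klEngC₃3 P R ≤ κ₀/(12(Gfr₂+1))` and
# `klEngU₀3 P R c ≤ min 1 (κ₀/(24(Gfr₀+Gfr₁+1)))`, with `κ₀ = min (min (Dt_min/4) (ρ_min/4)) (1/40) = 1/40` on the engine's band window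

Cell `gate-hubbard-kl`, seat hubbard-kl-k3c2-p3 (g3).  p4 g7's frame-keyed symbol-layer corollaries — the overlap sizes `hrow′/hcol′` of
the single-scale step (`TorusFourierL2.overlap_sums_klAniso_bgmFat_of_frameOK`, p494664) and the isotropic torus bound (J3) feeding p3 g6's
`EngineV8.IsoTorusBoundAt` (…EngineIsoTorusDefs) — are proved under the ABSOLUTE thresholds `c ≤ κ₀/(12(R.Gfr 2+1))`,
`U ≤ min 1 (κ₀/(24(R.Gfr 0 + R.Gfr 1 + 1)))` with `κ₀ := min (min (B.Dtmin/4) (B.rhomin/4)) (1/40)`, `B = bandBounds` of the level window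
`[-6/5, -1/10]`, while the registered stubs of `KLRegimeEngineV14` (stmt-HubbardSuperconductivity-19918) bind `c ≤ klEngC₃3 P R` and
`U ≤ klEngU₀3 P R c`.  This file is the bridge (companion of p3's `…EngineThresholdBridges`: `β² ≤ L`, `β ≤ M`):

* `cDtmin_engineWindow_ge`, `cRhomin_engineWindow_ge` — `Dt_min(-6/5,-1/10) ≥ 33/100`, `ρ_min(-6/5,-1/10) ≥ 4/25` (from
  `klfs_cDtmin_ge` / `klfs_cRhomin_ge`); hence **`symbolKappa_eq`**: `min (min (B.Dtmin/4) (B.rhomin/4)) (1/40) = 1/40` EXACTLY;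
* **`klEngC₃3_le_div_of_le`**, **`klEngU₀3_le_min_div_of_le`** — for ANY `κ ≥ 2⁻¹⁰⁰` (so the bridge survives any later change of the
  absolute constant): `klEngC₃3 P R ≤ κ/(12(R.Gfr 2+1))`, `klEngU₀3 P R c ≤ min 1 (κ/(24(R.Gfr 0+R.Gfr 1+1)))` (`Gfr ≥ 0`);
* **`klEngC₃3_le_symbolC₃`**, **`klEngU₀3_le_symbolU₀`** — the instances at p4's literal `κ₀`.

Pure inequalities between the package numerals; nothing about the model is asserted.
-/

namespace Summit.HubbardSuperconductivity.HubbardSuperconductivity.Theorems.EngineV8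

set_option linter.dupNamespace false -- summit = problem name (single-conjunct summit), D-0017

noncomputable section

open Real Finset Literature.MathematicalPhysics.QuantumLattice Literature.MathematicalPhysics.QuantumLattice.BandSectorCounting
open Summit.HubbardSuperconductivity.HubbardSuperconductivity.Theorems.KLRegimeSplit

/-! ## §1 The band window of the engine: `Dt_min`, `ρ_min` and `κ₀ = 1/40` -/

/-- `Dt_min(-6/5, -1/10) ≥ 33/100` (`klfs_cDtmin_ge`: `√0.39·√2.8/π ≈ 0.3326`). -/
theorem cDtmin_engineWindow_ge : (33 : ℝ) / 100 ≤ cDtmin (-(6 / 5)) (-(1 / 10)) := by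
  have h := klfs_cDtmin_ge (a := (-(6 / 5) : ℝ)) (b := (-(1 / 10) : ℝ)) (by norm_num) (by norm_num)
  have h1 : (0.624 : ℝ) ≤ Real.sqrt (-(-(1 / 10) : ℝ) * (4 + -(1 / 10))) := Real.le_sqrt_of_sq_le (by norm_num)
  have h2 : (1.673 : ℝ) ≤ Real.sqrt ((-(6 / 5) : ℝ) + 4) := Real.le_sqrt_of_sq_le (by norm_num)
  have hπ := Real.pi_lt_d2
  have hπ0 := Real.pi_pos
  have h3 : (33 : ℝ) / 100 ≤ Real.sqrt (-(-(1 / 10) : ℝ) * (4 + -(1 / 10))) * Real.sqrt ((-(6 / 5) : ℝ) + 4) / π := by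
    rw [le_div_iff₀ hπ0]
    nlinarith [Real.sqrt_nonneg (-(-(1 / 10) : ℝ) * (4 + -(1 / 10))), Real.sqrt_nonneg ((-(6 / 5) : ℝ) + 4)]
  exact h3.trans h

/-- `ρ_min(-6/5, -1/10) ≥ 4/25` (`klfs_cRhomin_ge`: `√0.39·√2.8/(2π) ≈ 0.1663`). -/
theorem cRhomin_engineWindow_ge : (4 : ℝ) / 25 ≤ cRhomin (-(6 / 5)) (-(1 / 10)) := by
  have h := klfs_cRhomin_ge (a := (-(6 / 5) : ℝ)) (b := (-(1 / 10) : ℝ)) (by norm_num) (by norm_num)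
  have h1 : (0.624 : ℝ) ≤ Real.sqrt (-(-(1 / 10) : ℝ) * (4 + -(1 / 10))) := Real.le_sqrt_of_sq_le (by norm_num)
  have h2 : (1.673 : ℝ) ≤ Real.sqrt ((-(6 / 5) : ℝ) + 4) := Real.le_sqrt_of_sq_le (by norm_num)
  have hπ := Real.pi_lt_d2
  have hπ0 := Real.pi_pos
  have h3 : (4 : ℝ) / 25 ≤ Real.sqrt (-(-(1 / 10) : ℝ) * (4 + -(1 / 10))) * Real.sqrt ((-(6 / 5) : ℝ) + 4) / (2 * π) := by
    rw [le_div_iff₀ (by positivity)]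
    nlinarith [Real.sqrt_nonneg (-(-(1 / 10) : ℝ) * (4 + -(1 / 10))), Real.sqrt_nonneg ((-(6 / 5) : ℝ) + 4)]
  exact h3.trans h

/-- **`κ₀ = 1/40` on the engine window**: for the generic bundle `B = bandBounds` of `[-6/5, -1/10]`,
`min (min (B.Dtmin/4) (B.rhomin/4)) (1/40) = 1/40` (both band branches exceed `1/40`). -/
theorem symbolKappa_eq (ha : (-4 : ℝ) < -(6 / 5)) (hab : (-(6 / 5) : ℝ) ≤ -(1 / 10)) (hb : (-(1 / 10) : ℝ) < 0) :
    min (min ((bandBounds ha hab hb).Dtmin / 4) ((bandBounds ha hab hb).rhomin / 4)) (1 / 40) = (1 : ℝ) / 40 := by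
  have hD : (bandBounds ha hab hb).Dtmin = cDtmin (-(6 / 5)) (-(1 / 10)) := rfl
  have hρ : (bandBounds ha hab hb).rhomin = cRhomin (-(6 / 5)) (-(1 / 10)) := rfl
  rw [hD, hρ]
  refine min_eq_right (le_min ?_ ?_)
  · linarith [cDtmin_engineWindow_ge]
  · linarith [cRhomin_engineWindow_ge]

/-- `2⁻¹⁰⁰ ≤ 1/40`. -/
theorem inv_two_pow_hundred_le_fortieth : (1 : ℝ) / 2 ^ 100 ≤ 1 / 40 :=
  one_div_le_one_div_of_le (by norm_num) (by norm_num)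

/-! ## §2 The package thresholds are below ANY absolute threshold `≥ 2⁻¹⁰⁰` -/

/-- `1 + (Gfr 2)² ≤ klEngRsq R` and `1 + (Gfr 0)² + (Gfr 1)² ≤ klEngRsq R`. -/
theorem one_add_gfr_sq_le_klEngRsq (R : RenConsts) :
    1 + R.Gfr 2 ^ 2 ≤ klEngRsq R ∧ 1 + R.Gfr 0 ^ 2 + R.Gfr 1 ^ 2 ≤ klEngRsq R := by
  unfold klEngRsq
  have h5 : ∑ j ∈ range 5, R.Gfr j ^ 2 = R.Gfr 0 ^ 2 + R.Gfr 1 ^ 2 + R.Gfr 2 ^ 2 + R.Gfr 3 ^ 2 + R.Gfr 4 ^ 2 := by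
    simp only [Finset.sum_range_succ, Finset.sum_range_zero, zero_add]
  rw [h5]
  constructor <;> nlinarith [sq_nonneg R.cr, sq_nonneg R.cz, sq_nonneg (R.Gfr 0), sq_nonneg (R.Gfr 1), sq_nonneg (R.Gfr 2),
    sq_nonneg (R.Gfr 3), sq_nonneg (R.Gfr 4)]

/-- **`klEngC₃3 P R ≤ κ/(12(Gfr₂+1))` for every `κ ≥ 2⁻¹⁰⁰`** (`Gfr 2 ≥ 0`):
`2⁻¹²⁰/(Psq·Rsq²) ≤ 2⁻¹⁰⁰/(12(Gfr₂+1))` since `12(Gfr₂+1) ≤ 24(1+Gfr₂²) ≤ 24·Rsq ≤ 2²⁰·Psq·Rsq²`. -/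
theorem klEngC₃3_le_div_of_le (P : SplitConsts) {R : RenConsts} (hR : 0 ≤ R.Gfr 2) {κ : ℝ} (hκ : (1 : ℝ) / 2 ^ 100 ≤ κ) :
    klEngC₃3 P R ≤ κ / (12 * (R.Gfr 2 + 1)) := by
  unfold klEngC₃3
  have hP := one_le_klEngPsq P
  have hRs1 : 1 ≤ klEngRsq R := one_le_klEngRsq R
  have hRs := (one_add_gfr_sq_le_klEngRsq R).1
  have hden : 0 < (2 : ℝ) ^ 120 * klEngPsq P * klEngRsq R ^ 2 := by positivity
  have hg : 0 < 12 * (R.Gfr 2 + 1) := by positivity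
  -- first `2⁻¹²⁰/(Psq Rsq²) ≤ 2⁻¹⁰⁰/(12(Gfr₂+1))`, then monotonicity in `κ`
  have hstep : 1 / ((2 : ℝ) ^ 120 * klEngPsq P * klEngRsq R ^ 2) ≤ (1 / 2 ^ 100) / (12 * (R.Gfr 2 + 1)) := by
    rw [div_div, div_le_div_iff₀ hden (by positivity), one_mul, one_mul]
    have h1 : 12 * (R.Gfr 2 + 1) ≤ 24 * (1 + R.Gfr 2 ^ 2) := by nlinarith [sq_nonneg (R.Gfr 2 - 1 / 2)]
    have h2 : klEngRsq R ≤ klEngRsq R ^ 2 := by nlinarith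
    have h3 : 24 * (1 + R.Gfr 2 ^ 2) ≤ 24 * (klEngPsq P * klEngRsq R ^ 2) := by
      have : 1 * (1 + R.Gfr 2 ^ 2) ≤ klEngPsq P * klEngRsq R ^ 2 :=
        mul_le_mul hP (hRs.trans h2) (by positivity) (by positivity)
      linarith
    have h4 : (2 : ℝ) ^ 100 * (12 * (R.Gfr 2 + 1)) ≤ 2 ^ 100 * (24 * (klEngPsq P * klEngRsq R ^ 2)) :=
      mul_le_mul_of_nonneg_left (h1.trans h3) (by positivity)
    calc (2 : ℝ) ^ 100 * (12 * (R.Gfr 2 + 1)) ≤ 2 ^ 100 * (24 * (klEngPsq P * klEngRsq R ^ 2)) := h4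
      _ ≤ 2 ^ 120 * klEngPsq P * klEngRsq R ^ 2 := by
          have h0 : 0 ≤ klEngPsq P * klEngRsq R ^ 2 := by positivity
          nlinarith
  exact hstep.trans (div_le_div_of_nonneg_right hκ hg.le)

/-- **`klEngU₀3 P R c ≤ min 1 (κ/(24(Gfr₀+Gfr₁+1)))` for every `κ ≥ 2⁻¹⁰⁰`** (`Gfr 0, Gfr 1 ≥ 0`). -/
theorem klEngU₀3_le_min_div_of_le (P : SplitConsts) {R : RenConsts} (hR0 : 0 ≤ R.Gfr 0) (hR1 : 0 ≤ R.Gfr 1) (c : ℝ) {κ : ℝ}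
    (hκ : (1 : ℝ) / 2 ^ 100 ≤ κ) :
    klEngU₀3 P R c ≤ min 1 (κ / (24 * (R.Gfr 0 + R.Gfr 1 + 1))) := by
  unfold klEngU₀3
  have hP := one_le_klEngPsq P
  have hRs1 : 1 ≤ klEngRsq R := one_le_klEngRsq R
  have hRs := (one_add_gfr_sq_le_klEngRsq R).2
  have hden : 0 < (2 : ℝ) ^ 120 * klEngPsq P ^ 2 * klEngRsq R ^ 4 * (c ^ 2 + 1) := by positivity
  have hg : 0 < 24 * (R.Gfr 0 + R.Gfr 1 + 1) := by positivity
  have hbig : (1 : ℝ) ≤ klEngPsq P ^ 2 * klEngRsq R ^ 4 * (c ^ 2 + 1) := by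
    have h1 : (1 : ℝ) ≤ klEngPsq P ^ 2 := one_le_pow₀ hP
    have h2 : (1 : ℝ) ≤ klEngRsq R ^ 4 := one_le_pow₀ hRs1
    have h3 : (1 : ℝ) ≤ c ^ 2 + 1 := by nlinarith [sq_nonneg c]
    calc (1 : ℝ) = 1 * 1 * 1 := by ring
      _ ≤ klEngPsq P ^ 2 * klEngRsq R ^ 4 * (c ^ 2 + 1) := by gcongr
  refine le_min ?_ ?_
  · rw [div_le_one hden]
    nlinarith
  · have hstep : 1 / ((2 : ℝ) ^ 120 * klEngPsq P ^ 2 * klEngRsq R ^ 4 * (c ^ 2 + 1)) ≤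
        (1 / 2 ^ 100) / (24 * (R.Gfr 0 + R.Gfr 1 + 1)) := by
      rw [div_div, div_le_div_iff₀ hden (by positivity), one_mul, one_mul]
      have h1 : 24 * (R.Gfr 0 + R.Gfr 1 + 1) ≤ 48 * (1 + R.Gfr 0 ^ 2 + R.Gfr 1 ^ 2) := by
        nlinarith [sq_nonneg (R.Gfr 0 - 1 / 2), sq_nonneg (R.Gfr 1 - 1 / 2)]
      have h2 : klEngRsq R ≤ klEngRsq R ^ 4 := by
        calc klEngRsq R = klEngRsq R ^ 1 := (pow_one _).symm
          _ ≤ klEngRsq R ^ 4 := pow_le_pow_right₀ hRs1 (by norm_num)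
      have h3 : 48 * (1 + R.Gfr 0 ^ 2 + R.Gfr 1 ^ 2) ≤ 48 * (klEngPsq P ^ 2 * klEngRsq R ^ 4 * (c ^ 2 + 1)) := by
        have hP2 : (1 : ℝ) ≤ klEngPsq P ^ 2 := one_le_pow₀ hP
        have hc1 : (1 : ℝ) ≤ c ^ 2 + 1 := by nlinarith [sq_nonneg c]
        have : 1 * (1 + R.Gfr 0 ^ 2 + R.Gfr 1 ^ 2) * 1 ≤ klEngPsq P ^ 2 * klEngRsq R ^ 4 * (c ^ 2 + 1) :=
          mul_le_mul (mul_le_mul hP2 (hRs.trans h2) (by positivity) (by positivity)) hc1 (by norm_num) (by positivity)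
        linarith
      have h4 : (2 : ℝ) ^ 100 * (24 * (R.Gfr 0 + R.Gfr 1 + 1)) ≤
          2 ^ 100 * (48 * (klEngPsq P ^ 2 * klEngRsq R ^ 4 * (c ^ 2 + 1))) :=
        mul_le_mul_of_nonneg_left (h1.trans h3) (by positivity)
      calc (2 : ℝ) ^ 100 * (24 * (R.Gfr 0 + R.Gfr 1 + 1)) ≤ 2 ^ 100 * (48 * (klEngPsq P ^ 2 * klEngRsq R ^ 4 * (c ^ 2 + 1))) := h4
        _ ≤ 2 ^ 120 * klEngPsq P ^ 2 * klEngRsq R ^ 4 * (c ^ 2 + 1) := by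
            have h0 : 0 ≤ klEngPsq P ^ 2 * klEngRsq R ^ 4 * (c ^ 2 + 1) := by positivity
            nlinarith
    exact hstep.trans (div_le_div_of_nonneg_right hκ hg.le)

/-! ## §3 The instances at p4's literal `κ₀ = min (min (B.Dtmin/4) (B.rhomin/4)) (1/40)` -/

/-- **`klEngC₃3 P R ≤ κ₀/(12(Gfr₂+1))`** at `κ₀ = min (min (B.Dtmin/4) (B.rhomin/4)) (1/40)`, `B = bandBounds` of `[-6/5,-1/10]`
(the `c`-threshold of `overlap_sums_klAniso_bgmFat_of_frameOK` and of the isotropic torus bound, from the stub binder `c ≤ klEngC₃3 P R`). -/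
theorem klEngC₃3_le_symbolC₃ (ha : (-4 : ℝ) < -(6 / 5)) (hab : (-(6 / 5) : ℝ) ≤ -(1 / 10)) (hb : (-(1 / 10) : ℝ) < 0)
    (P : SplitConsts) {R : RenConsts} (hR : ∀ j, 0 ≤ R.Gfr j) :
    klEngC₃3 P R ≤ min (min ((bandBounds ha hab hb).Dtmin / 4) ((bandBounds ha hab hb).rhomin / 4)) (1 / 40) / (12 * (R.Gfr 2 + 1)) := by
  rw [symbolKappa_eq ha hab hb]
  exact klEngC₃3_le_div_of_le P (hR 2) inv_two_pow_hundred_le_fortieth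

/-- **`klEngU₀3 P R c ≤ min 1 (κ₀/(24(Gfr₀+Gfr₁+1)))`** at the same `κ₀` (the `U`-threshold of the symbol-layer corollaries, from the stub
binder `U ≤ klEngU₀3 P R c`). -/
theorem klEngU₀3_le_symbolU₀ (ha : (-4 : ℝ) < -(6 / 5)) (hab : (-(6 / 5) : ℝ) ≤ -(1 / 10)) (hb : (-(1 / 10) : ℝ) < 0)
    (P : SplitConsts) {R : RenConsts} (hR : ∀ j, 0 ≤ R.Gfr j) (c : ℝ) :
    klEngU₀3 P R c ≤
      min 1 (min (min ((bandBounds ha hab hb).Dtmin / 4) ((bandBounds ha hab hb).rhomin / 4)) (1 / 40) / (24 * (R.Gfr 0 + R.Gfr 1 + 1))) := by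
  rw [symbolKappa_eq ha hab hb]
  exact klEngU₀3_le_min_div_of_le P (hR 0) (hR 1) c inv_two_pow_hundred_le_fortieth

/-- The stub binder `R.WF2` gives the sign hypotheses `∀ j, 0 ≤ R.Gfr j` of the symbol-layer corollaries. -/
theorem gfr_nonneg_of_wf2 {R : RenConsts} (hR : R.WF2) : ∀ j, 0 ≤ R.Gfr j := hR.1.2.2

end

end Summit.HubbardSuperconductivity.HubbardSuperconductivity.Theorems.EngineV8
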